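import Literature.Probability.Percolation.CardyFormula
import Literature.Probability.RandomPlanarGeometry.SelfAvoidingWalk
import Literature.Probability.Percolation.CriticalContinuity
import Literature.Probability.LatticeModels.ScalingLimit3D
import HarnessLib

/-!
# CriticalPhenomena / Ising3DConformalLimit — sub-problem statement (D-0017)

Moved out of `Summits/CriticalPhenomena/Statement.lean` with the declaration text unchanged.
-/

/-- Conjunct `Ising3DConformalLimit` of `CriticalPhenomena`: **the critical Ising model on `ℤ³`
has a conformally (Möbius) covariant scaling limit** — for the nearest-neighbour Ising model on
`ℤ³` (coupling `1`, field `h = 0`, `β = β_c(3) := inf {β ≥ 0 | m*(β) > 0}`, `+` state; the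
setting of Aizenman–Duminil-Copin–Sidoravicius 2015, §1) there exist a renormalisation
`ρ : (0,1] → (0,∞)`, a scaling dimension `Δ > 0` and continuum `n`-point functions `S` such
that `ρ(δ)^n ⟨σ_{[x₁/δ]} ⋯ σ_{[xₙ/δ]}⟩⁺_{β_c} → S n (x₁,…,xₙ)` as `δ → 0⁺`, locally uniformly on
non-coincident `(x₁,…,xₙ) ∈ (ℝ³)ⁿ`, with (i) `S 2 > 0` off the diagonal, (ii) `S` covariant with
weight `∏ᵢ |φ'(xᵢ)|^{-Δ}` under translations, `O(3)`, dilations and the unit inversion (a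
generating set of the Möbius group of `ℝ³ ∪ {∞}`), (iii) connected four-point function
`U₄ ≢ 0` (non-Gaussian limit). Covariance reading of "conformal invariance of the 3-D Ising
critical point" (Poland–Rychkov–Vichi 2019, §II eq. (2); Duminil-Copin, ICM 2022, §8.1
(8.1)–(8.3) and §8.4: "proving that the critical 3D Ising model indeed converges to a CFT [is]
widely open"); shape of Chelkak–Hongler–Izyurov 2015, Thm 1.2 / Remark 1.4 (bulk limit),
transposed to `ℝ³`. NOT the full CFT/OPE axioms. The Literature statement
`Literature.Probability.LatticeModels.CritIsing3DConformalLimit`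
(`Literature/Probability/LatticeModels/ScalingLimit3D.lean`), imported not restated.
[cite: AizenmanDuminilCopinSidoravicius2015, §1 (setting: n.n. ℤ³, β_c, + state)]
[cite: PolandRychkovVichi2019, §II eq. (2)] [cite: ChelkakHonglerIzyurov2015, Thm 1.2 and Remark 1.4]
[cite: ICM2022, §8.1 (8.1)–(8.3) and §8.4] [problem: crit-ising] -/
abbrev Ising3DConformalLimit : Prop := Literature.Probability.LatticeModels.CritIsing3DConformalLimit
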